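import Summits.CriticalPhenomena.Ising3DConformalLimit.Theorems.SubPtolemyInterlacingSubPtolemyFloorHybridCloses
import Summits.CriticalPhenomena.Ising3DConformalLimit.Theorems.SubPtolemyInterlacingSubPtolemyFloorConditionalClosings

/-!
# Line `HybridCloses` of crux stmt-CriticalPhenomena-15703 `SubPtolemyFloor` (r3) — STATUS (lead a1, cycle 1)

**What this line is.** Not a proof skeleton for r3 (it has no `stub_*` whose composition concludes
`SubPtolemyFloor`; no such stub short of the crux itself is known — see the three dead round-1 lines and
`Theorems/SubPtolemyFloor/Negative/TransferCostume.lean`). It is the kernel-checked certificate that the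
ROUTE does not need r3, now LANDED (p134930, p135087) as
`Theorems/SubPtolemyInterlacingSubPtolemyFloorHybridCloses.lean`, namespace
`Summit.CriticalPhenomena.Ising3DConformalLimit.SubPtolemyFloorHybrid`:

* `hasNontrivialU4_of_interlacing_of_window` — `Interlacing` alone ⇒ `U₄ ≢ 0` for every non-degenerate,
  translation-invariant, scale-covariant pointwise limit with `2Δ < log₂(1+√2)` (r5 with the floor
  replaced by the window it was used for).
* `hybrid_closes : Interlacing → AnomalousForcesInteraction.GaussianLimitIsFree → MoebiusLimit →
  Ising3DConformalLimit` — OPTION A for the planner: drop r3, attach item stmt-CriticalPhenomena-2601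
  (`U₄ ≡ 0 ⇒ Δ = 1/2`, sibling route AnomalousForcesInteraction, difficulty XL) to this route.
* `conditionalEta_closes : Interlacing → (∀ η, HasIsingExponentEta 3 η → η < log₂(1+√2) - 1) →
  MoebiusLimit → Ising3DConformalLimit` — OPTION B: restate r3 as the CONDITIONAL exponent inequality
  "if η(3) exists then η(3) < 0.2716" (the shape of Duminil-Copin–Panis 2025 Thm 1.5, which gives `≤ 1/2`);
  it suffices because `MoebiusLimit` makes `η = 2Δ - 1` exist (`hasIsingExponentEta_of_scaleCovariant_limit`),
  and it is implied by r3 (`conditionalEta_of_subPtolemyFloor`), so it is a genuine weakening — still open,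
  but constant-free and exactly what `closes` consumes.
* (landed earlier, lead c2) `SubPtolemyFloorPlusWall.subPtolemyFloor_of_hasIsingExponentEta` — the converse
  bridge: η exists ∧ η < 0.2716 ⇒ r3 as filed.

**Verdict on r3 itself** (four leads concur, quantitative): open problem "one-sided η(3) < 0.2716";
rigorous frontier = exponent 2 for all n (Simon–Lieb), 3/2 along a subsequence unconditionally
(`frequently_rpow_le_criticalTwoPoint_axis`, p131841), 3/2 for all n conditionally on η-existence
(DCP 2025 Thm 1.5, tree `dcp_isingEta_le_half_holds`); inside the route (given `MoebiusLimit`)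
r3 ↔ `2Δ < log₂(1+√2)` exactly (`SubPtolemyFloorNegative.two_mul_dim_lt_threshold_of_crux` and §3 of
`Disproof.lean`). No line can change that; only an ENGINE (a new lower-bound mechanism for critical
correlations on ℤ³ beating the reflected-gradient inequality DCP Thm 1.2 by a power) would.

The three aliases below re-export the closings so that `ledger skeleton check` / the disprover see this
file elaborate (rc 0, 0 sorries).
-/

namespace Summit.CriticalPhenomena.Ising3DConformalLimit.Cruxes.SubPtolemyFloor.Lines.HybridCloses

open Literature.Probability.LatticeModels
open Summit.CriticalPhenomena.Ising3DConformalLimit.Theses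
open Summit.CriticalPhenomena.Ising3DConformalLimit.Theses.SubPtolemyInterlacing
open Summit.CriticalPhenomena.Ising3DConformalLimit.SubPtolemyFloorHybrid

/-- OPTION A (landed `hybrid_closes`): the conjunct from `Interlacing`, `GaussianLimitIsFree` (item 2601)
and `MoebiusLimit`, with no axial floor. [cite: Newman1975, Theorem 6 (Gaussian ⇔ vanishing fourth cumulant in the Lee–Yang class)] -/
theorem optionA_closes (hI : Interlacing) (hGF : AnomalousForcesInteraction.GaussianLimitIsFree)
    (hML : MoebiusLimit) : _root_.Ising3DConformalLimit :=
  hybrid_closes hI hGF hML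

/-- OPTION B (landed `conditionalEta_closes`): the conjunct from `Interlacing`, the conditional exponent
inequality and `MoebiusLimit`. [cite: DuminilCopinPanis2025LowerBounds, Theorem 1.5] -/
theorem optionB_closes (hI : Interlacing)
    (hC : ∀ η : ℝ, HasIsingExponentEta 3 η → η < Real.logb 2 (1 + Real.sqrt 2) - 1)
    (hML : MoebiusLimit) : _root_.Ising3DConformalLimit :=
  conditionalEta_closes hI hC hML

/-- OPTION B is a weakening of the filed r3 (landed `conditionalEta_of_subPtolemyFloor`). [folklore] -/
theorem optionB_of_crux (h : SubPtolemyFloor) :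
    ∀ η : ℝ, HasIsingExponentEta 3 η → η < Real.logb 2 (1 + Real.sqrt 2) - 1 :=
  conditionalEta_of_subPtolemyFloor h

/-- The route as filed still closes (landed r5 + `closes`), for comparison: r3 is the only open
non-imported hypothesis besides `Interlacing`. [folklore] -/
theorem asFiled_closes (hI : Interlacing) (hF : SubPtolemyFloor) (hML : MoebiusLimit) :
    _root_.Ising3DConformalLimit :=
  SubPtolemyInterlacing.closes hI hF hML Theorems.interlacingForcesU4_proof

end Summit.CriticalPhenomena.Ising3DConformalLimit.Cruxes.SubPtolemyFloor.Lines.HybridCloses
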